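import Summits.Langlands.Langlands.Theorems.ExtendedAdequacySplitProduct

/-!
# Route ExtendedAdequacySplit rev 1 — the split GLUE item `CoreIrreducibleInadequateLifting_of_split`

The glue item (stmt-Langlands-27083) of the D-0170 split (gen 1) of the declared residual CORE
`ExtendedAdequacySplit.CoreIrreducibleInadequateLifting` (stmt-Langlands-26842) into CPR `CoreIrreducibleProductLifting`
(stmt-Langlands-27081, support) and CORE′ `CoreIrreducibleNonProductLifting` (stmt-Langlands-27082, residual), filed by
writer-1 (ROUTE-EDIT L1201, rev 1 @54ed63ef9b7c) from the lens-5-g13 rev-1 kit: `CPR → CORE′ → CORE`.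

Proof: the route decls CPR / CORE′ are, definitionally, the twin's `…Theorems.CoreAdequacy.ExtAdequacy.Product.CoreIrreducibleProductLifting`
/ `…CoreIrreducibleNonProductLifting` (same text; `Iff.rfl` below), and the landed twin theorem
`Summit.Langlands.Langlands.Theorems.CoreAdequacy.ExtAdequacy.Product.core_route_of_product_cells` (p795319, `Theorems/ExtendedAdequacySplitProduct.lean`;
one `Classical.em` on the dial `SolvablyFunctorialProduct`) concludes the route's CORE by name.  (The gate refused this decl as `--glue-by` only because its
module imports the route file — `glue.cyclic-import`; a Theorems file proving a route item may import it.)  Nothing here proves `Langlands` (nor CORE).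
-/

set_option linter.dupNamespace false -- project-wide option (lakefile weak.linter.dupNamespace); `Summit.Langlands.Langlands` is the mandated namespace

namespace Summit.Langlands.Langlands.Theorems.CoreAdequacy.ExtAdequacy.ProductGlue

open Summit.Langlands.Langlands.Theses

/-- The route's CPR (rev 1 item 27081) is the twin's CPR, definitionally. [kernel certificate] -/
theorem coreIrreducibleProductLifting_route_iff_twin :
    ExtendedAdequacySplit.CoreIrreducibleProductLifting ↔
      Summit.Langlands.Langlands.Theorems.CoreAdequacy.ExtAdequacy.Product.CoreIrreducibleProductLifting := Iff.rfl

/-- The route's CORE′ (rev 1 item 27082) is the twin's CORE′, definitionally. [kernel certificate] -/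
theorem coreIrreducibleNonProductLifting_route_iff_twin :
    ExtendedAdequacySplit.CoreIrreducibleNonProductLifting ↔
      Summit.Langlands.Langlands.Theorems.CoreAdequacy.ExtAdequacy.Product.CoreIrreducibleNonProductLifting := Iff.rfl

/-- **Glue of the split of CORE 26842** (stmt-Langlands-27083): `CPR → CORE′ → CORE`, by the landed twin theorem
`core_route_of_product_cells`. -/
theorem coreIrreducibleInadequateLifting_of_split_proof :
    ExtendedAdequacySplit.CoreIrreducibleInadequateLifting_of_split := by
  unfold ExtendedAdequacySplit.CoreIrreducibleInadequateLifting_of_split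
  intro hP hC
  exact Summit.Langlands.Langlands.Theorems.CoreAdequacy.ExtAdequacy.Product.core_route_of_product_cells
    (coreIrreducibleProductLifting_route_iff_twin.1 hP) (coreIrreducibleNonProductLifting_route_iff_twin.1 hC)

end Summit.Langlands.Langlands.Theorems.CoreAdequacy.ExtAdequacy.ProductGlue
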